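import Mathlib
import HarnessLib
import Summits.ValiantsHypothesis.ValiantsHypothesis.Theses.MonotoneRestoration
import Literature.Computability.AlgebraicComplexity.ArithCircuit
import Literature.Computability.AlgebraicComplexity.ArithCircuitProofs
import Literature.Computability.AlgebraicComplexity.MonotoneStructure
import Literature.Computability.AlgebraicComplexity.PermanentIrreducible
import Literature.ModelTheory.FiniteModelTheory.CkEquiv
import Summits.ValiantsHypothesis.ValiantsHypothesis.Theorems.MonotoneRestorationMonotoneRestorationQPCosetCount
import Summits.ValiantsHypothesis.ValiantsHypothesis.Theorems.MonotoneRestorationMonotoneRestorationQPSymmetricLB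
import Summits.ValiantsHypothesis.ValiantsHypothesis.Theorems.MonotoneRestorationMonotoneRestorationQPSupportSymmetrisation
import Summits.ValiantsHypothesis.ValiantsHypothesis.Theorems.MonotoneRestorationMonotoneRestorationQPSparseRegime
import Summits.ValiantsHypothesis.ValiantsHypothesis.Theorems.MonotoneRestorationMonotoneRestorationQPBeta
import Literature.Computability.AlgebraicComplexity.SymmetricArithCircuit
import Literature.Computability.AlgebraicComplexity.DawarWilsenach2025Proofs
import Literature.GroupTheory.PermutationGroups.SmallIndexSubgroups
import Summits.ValiantsHypothesis.ValiantsHypothesis.Theorems.MonotoneRestorationQP.Negative.LoadBearing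
import Summits.ValiantsHypothesis.ValiantsHypothesis.Theorems.MonotoneRestorationMonotoneRestorationQPPermSupportCount
import Summits.ValiantsHypothesis.ValiantsHypothesis.Theorems.PerDivisionHard.Negative.PlainBridge

/-! TTRL-lite variant V14275 of stmt-ValiantsHypothesis-15886 -/

set_option linter.dupNamespace false

namespace Summit.ValiantsHypothesis.ValiantsHypothesis.Theorems

open Summit.ValiantsHypothesis.ValiantsHypothesis.Theses.MonotoneRestoration
open Literature.Computability.AlgebraicComplexity

/-- TTRL-lite variant V14275 (`σ := Fin 3`) of `stub_monotoneComputation_of_complexity`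
(stmt-ValiantsHypothesis-15886): over `ℝ≥0` every polynomial has a Jerrum–Snir monotone computation
(plain fan-in-two circuit) of size at most `3 · complexity f` — each weighted gate `c • u + d • v` of a
size-optimal fan-in-two circuit becomes the three plain gates `c ⊗ u`, `d ⊗ v`, `⊕`
(`PerDivisionHardNegative.Plainify`). [cite: JerrumSnir1982, §2.2] -/
theorem stub_monotoneComputation_of_complexity_var14275 :
    ∀ (f : MvPolynomial (Fin 3) NNReal), ∃ P : ArithCircuit NNReal (Fin 3),
      Literature.Barriers.ValiantsHypothesis.IsMonotoneComputation P f ∧ P.size ≤ 3 * complexity f := by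
  intro f
  obtain ⟨P, h2, hf, hs⟩ := ArithCircuit.exists_computes_size_eq_complexity f
  refine ⟨Summit.ValiantsHypothesis.Theorems.PerDivisionHardNegative.Plainify.circuit P,
    ⟨?_, ?_, Summit.ValiantsHypothesis.Theorems.PerDivisionHardNegative.Plainify.computes h2 hf⟩, ?_⟩
  · intro g' hg'
    obtain ⟨j, g, hg, hj⟩ :=
      Summit.ValiantsHypothesis.Theorems.PerDivisionHardNegative.Plainify.mem_gatesAux hg'
    exact Summit.ValiantsHypothesis.Theorems.PerDivisionHardNegative.Plainify.fanIn_of_mem_triple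
      (h2 g hg) hj
  · intro g' hg'
    obtain ⟨j, g, -, hj⟩ :=
      Summit.ValiantsHypothesis.Theorems.PerDivisionHardNegative.Plainify.mem_gatesAux hg'
    exact Summit.ValiantsHypothesis.Theorems.PerDivisionHardNegative.Plainify.isPlainGate_of_mem_triple hj
  · rw [← hs]
    show (Summit.ValiantsHypothesis.Theorems.PerDivisionHardNegative.Plainify.gatesAux 0 P.gates).length
        ≤ 3 * P.gates.length
    rw [Summit.ValiantsHypothesis.Theorems.PerDivisionHardNegative.Plainify.length_gatesAux]

end Summit.ValiantsHypothesis.ValiantsHypothesis.Theorems
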